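import Summits.QuantumFields.YangMills.Theorems.BalabanUVNodesN16SlotWindow
import HarnessLib

/-!
# Route «BalabanUVNodes», cluster K4 «SpineRates» — node N16 = NE3: THE N16 LINE AT THE READING OF RECORD WITH WINDOWED LETTERS — for the reading of record
# `readingOfRecord₁₂ w1 ℓ ne2 ne1` whose NE3 letters `ℓ F` lie in N05's averaging window (file 13's recipe), the three CONTENT clauses of N16's slot once per
# family give dag-n27-c's `h16 : S_N16 (RRec₁₂On (readingOfRecord₁₂ …) Rg)` and dag-n21-d's `h16 : S_N16 (RRec₁₂ (readingOfRecord₁₂ …))`; every other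
# hypothesis is a displayed letter inequality

Cell `pub-ymgap`, seat `pub-ymgap-dag-n16-e` (R134 acceleration seat (a), strategy s2 = BY-NAME KNIT at the record; HUMAN RULING D-0062; chair R424 venue),
generation 4, file 14 (THEOREMS ONLY, 0 `def`, 0 `sorry`, standard axioms).  `bears_on: R4∕N16 · K3′ SpineGivenEndpointR12 (stmt-QuantumFields-19908)`.  Filed
`--supports stmt-QuantumFields-19908 --as helper`.  Imports this seat's file 13 `BalabanUVNodesN16SlotWindow` (`leafSlot_ofRecord_of_window`,
`inEndRegime_ofRecord_of_window`; through it file 12 `…N16AtRRec12On` p474753: `s_N16_rRec₁₂On_readingOfRecord₁₂_of_leafSlot`, file 8 `…N16AtRRec12ConstLayer`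
p467313: `s_N16_rRec₁₂_of_constLayer_leafSlot`, dag-n22-e's `readingOfRecord₁₂` with its `rfl` NE3 face, RR-1's `ne3ConstLayerOfRecord₁₁`).  Restates nothing.

WHY.  The knits of record at the named reading (file 12 §6 `…_of_letters_of_leafSlot`, dag-n21-d 11b §3) pin the class-radius letter at THE END's opaque radius
`r`, where the slot cannot be certified inhabitable (file 13 §1, LOCATED-3).  With the letters WINDOWED (file 13 §2) the slot IS its content; this file says so at
the reading of record in one sentence per home: what N16 then owes the K3′ composer at `readingOfRecord₁₂ w1 ℓ ne2 ne1` is — per family — N05's two typed leaf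
clauses on the univ sub-family of `zdGF3 (M_N ℂ) F.L 1 (len F)` and N07's `LeafH3sup 4 F.L (2·L^m) (ℓ F).ε (b' F) (c' F) (ne3DomOfRecord₁₁ F N 0 0)`, at letters
any consumer can meet (file 13 §3).

CONTENT ([folklore] bookkeeping, one application per family).
* `s_N16_rRec₁₂On_readingOfRecord₁₂_of_window` — regime-restricted home `RRec₁₂On … Rg` (content asked once per GUARDED family: an admissible Stage-12 tuple
  with provisos in `Rg`); dag-n27-c's `h16`.
* `s_N16_rRec₁₂_readingOfRecord₁₂_of_window` — canonical home `RRec₁₂` (content asked once per family carrying a Stage-12 datum of record); dag-n21-d's `h16`.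

HONEST FRAMING.  Kernel bookkeeping over files 8 ∕ 12 ∕ 13; the three content clauses are HYPOTHESES (N05's leaf modulo its sockets — at Hölder exponent `β = 1` as
typed, dag-n16-c LOCATED-N16-HOLDER-PIN, ruling awaited; N07's [Balaban1985Variational] Thm 1 (8)+(10) TYPE), asserted for no family; `w1`, `ne2`, `ne1`, `ℓ` and
N05's constants are PARAMETERS; no inhabitant of `IsDatumOfRecord₁₂C` claimed (K0′ open); **N16 ∕ NE3 NOT discharged**; count-neutral; one finite four-torus at fixed
ε — NOT ℝ⁴, NOT infinite volume, NOT OS, NOT a mass gap, NOT Clay.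
-/

set_option autoImplicit false

open scoped BigOperators Matrix Matrix.Norms.L2Operator
open NormedSpace

namespace Summit.QuantumFields.YangMills.BalabanUVNodes.N16SlotWindowReading

open Literature.MathematicalPhysics.QuantumFieldTheory.Balaban1983to89
open Literature.MathematicalPhysics.QuantumFieldTheory.Balaban1983to89.T4Continuum (T4Family ULoop)
open B7Prop1Explicit B7Prop2Explicit
open B7Prop3Flat (c3)
open B8LeafModelZd (ZdIdx)
open B8LeafModelZd3 (zdGF3)
open Node00 (IsDatumOfRecord₁₂C Stage12Params NE3Letters₁₁ NE2Objects₁₁ ne3ConstLayerOfRecord₁₁ ne3NperOfRecord₁₁ ne3DomOfRecord₁₁ one_le_ne3NperOfRecord₁₁)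
open Summit.QuantumFields.BalabanUV.T4Continuum
open BlockAverageCurrent (curConst)
open NE3RightInverseSupLetters (frameC)
open NE3.LeafIndexSockets (LeafH3sup)
open YMDAG.UVSplit (Datum NE1pCarriers S_N16 RRec₁₂ RRec₁₂On readingOfRecord₁₂)
open Summit.QuantumFields.YangMills.BalabanUVNodes.N16Regime (radiusOfRecord constOfRecord)
open Summit.QuantumFields.YangMills.BalabanUVNodes.N16AtRRec12ConstLayer (s_N16_rRec₁₂_of_constLayer_leafSlot)
open Summit.QuantumFields.YangMills.BalabanUVNodes.N16AtRRec12On (s_N16_rRec₁₂On_readingOfRecord₁₂_of_leafSlot)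
open Summit.QuantumFields.YangMills.BalabanUVNodes.N16SlotWindow (leafSlot_ofRecord_of_window inEndRegime_ofRecord_of_window)

noncomputable section

variable {N : ℕ} [NeZero N]

section ReadingOfRecord

variable (Rg : (F : T4Family) → Stage12Params F N → Prop)
  (w1 : (F : T4Family) → (θ : Stage12Params F N) → Node00.W1.ReadingData F (Node00.MatA N) θ.τ9.M)
  (ne2 : (F : T4Family) → Stage12Params F N → (ℕ → ℝ) → List (ULoop F) → ℕ → NE2Objects₁₁)
  (ne1 : (F : T4Family) → Stage12Params F N → (ℕ → ℝ) → List (ULoop F) → NE1pCarriers)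
  (ℓ : T4Family → NE3Letters₁₁)
  -- N05's constants, per family (they may depend on the block factor `F.L`)
  (len : T4Family → Site 4 → ℝ) (c₁ c₁' B₁' cP C₂ B₀β : T4Family → ℝ) (inp : T4Family → B8.B9Inputs)
  -- the averaging letter in N05's window and N07's leaf letters, per family
  (α b' c' : T4Family → ℝ)

/-- **THE N16 LINE AT THE READING OF RECORD, REGIME-RESTRICTED HOME, WINDOWED LETTERS.**  For the reading of record `readingOfRecord₁₂ w1 ℓ ne2 ne1` whose NE3 letters `ℓ F`
are WINDOWED (per family: N05's constants with the eleven-line window at `c₁' F` and `5·4·F.L·B₀ ≤ B₁'`, the averaging letter `α F` under the five displayed bounds, `0 < ε < α`,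
`Λ₁ ≤ r`, `0 ≤ b ≤ ε∕2`, `0 < g`, `Cof g ≤ C`, `177·α·(B_h+B) ≤ Λ₂'`, N07's `0 ≤ b', c' ≤ α²`), the three CONTENT clauses once per guarded family — N05's `Thm4Body`,
`Prop3Body` on the univ sub-family of `zdGF3 (M_N ℂ) F.L 1 (len F)`, N07's `LeafH3sup 4 F.L (2·L^m) (ℓ F).ε (b' F) (c' F) (ne3DomOfRecord₁₁ F N 0 0)` — give dag-n27-c's
binder `h16`: `S_N16 (RRec₁₂On (readingOfRecord₁₂ w1 ℓ ne2 ne1) Rg)`.  Every hypothesis other than the content is a displayed letter inequality; the content is asserted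
for no family here. [folklore] -/
theorem s_N16_rRec₁₂On_readingOfRecord₁₂_of_window
    (hlen : ∀ (F : T4Family) (v : Site 4), 0 < len F v → 1 ≤ len F v) (hlen1 : ∀ (F : T4Family) (μ : Fin 4), len F (e μ) = 1)
    (hB₁' : ∀ F, 0 < B₁' F) (hBB : ∀ F : T4Family, 5 * ((4 : ℕ) : ℝ) * F.L * (inp F).B₀ ≤ B₁' F) (hc₁' : ∀ F, 0 < c₁' F)
    (hwin : ∀ (F : T4Family) (α₀ α₁ : ℝ), 0 < α₀ → 0 < α₁ → α₀ + α₁ ≤ c₁' F →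
      α₀ + α₁ ≤ c₁ F ∧ C0 4 * (2 * α₀) ≤ 1 / 3 ∧ 4 * α₀ ≤ c2' 4 F.L ∧ 16 * (B₁' F * (α₀ + α₁)) ≤ 1 ∧
      Real.exp (4 * (800 * (((4 : ℕ) : ℝ) + 1) ^ 2 * (((4 : ℕ) : ℝ) + 4)) * α₀) * (1 + 8 * (131072 * (((4 : ℕ) : ℝ) + 1) ^ 2) * (B₁' F * (α₀ + α₁))) ≤ 2 ∧
      2 * (B₁' F * (α₀ + α₁)) ≤ c3 4 F.L ∧ ((4 : ℕ) : ℝ) * F.L * α₁ ≤ 1 / 8 ∧ α₀ ≤ cP F ∧ α₁ ≤ cP F ∧ B₁' F * (α₀ + α₁) ≤ cP F ∧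
      2 * (B₁' F * (α₀ + α₁)) ^ 2 + 20 * ((4 : ℕ) : ℝ) * α₀ * (B₁' F * (α₀ + α₁)) + 2 * C₂ F * (B₁' F * (α₀ + α₁)) ^ 2 ≤ α₀ + α₁)
    (hα : ∀ F, 0 < α F) (hα1 : ∀ F, α F ≤ c₁' F / 177)
    (hα2 : ∀ F : T4Family, α F ≤ (ℓ F).Λ₁ / (1770 * (5 * ((4 : ℕ) : ℝ) * F.L * (inp F).B₀) + 1))
    (hα3 : ∀ F : T4Family, α F ≤ c2' 4 F.L / 2)
    (hα4 : ∀ F : T4Family, α F ≤ 1 / ((23040 * (4 : ℝ) ^ 4 * (frameC 4 F.L + 4) ^ 3 + 12) * (1 + curConst 4 F.L) + 1))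
    (hα5 : ∀ F, α F ≤ 1 / 10 ^ 9)
    (hg : ∀ F, 0 < (ℓ F).g) (hε0 : ∀ F, 0 < (ℓ F).ε) (hε : ∀ F, (ℓ F).ε < α F)
    (hΛ₁r : ∀ F : T4Family, (ℓ F).Λ₁ ≤ radiusOfRecord N F.L (ne3NperOfRecord₁₁ F 0 0))
    (hb : ∀ F, 0 ≤ (ℓ F).b ∧ (ℓ F).b ≤ (ℓ F).ε / 2) (hC : ∀ F : T4Family, constOfRecord N F.L (ne3NperOfRecord₁₁ F 0 0) (ℓ F).g ≤ (ℓ F).C)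
    (hΛ₂' : ∀ F : T4Family, 177 * α F * (5 * ((4 : ℕ) : ℝ) * F.L * B₀β F + 5 * ((4 : ℕ) : ℝ) * F.L * (inp F).B₀) ≤ (ℓ F).Λ₂')
    (hb' : ∀ F, 0 ≤ b' F ∧ b' F ≤ α F ^ 2) (hc' : ∀ F, 0 ≤ c' F ∧ c' F ≤ α F ^ 2)
    (hcontent : ∀ (F : T4Family), (∃ θ : Stage12Params F N, θ.Provisos₁₂ F N ∧ Rg F θ ∧ θ.Admissible F N) →
      letI : CStarAlgebra (Matrix (Fin N) (Fin N) ℂ) := {}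
      B8.Thm4Body (c₁ F) (B₁' F) (fun i : {i : ZdIdx 4 F.L // i.Ω 0 = Set.univ} => (zdGF3 (Matrix (Fin N) (Fin N) ℂ) F.L 1 (len F) i.1).toGFData) ∧
        B8.Prop3Body (cP F) 4 (F.L : ℝ) (C₂ F) (inp F) (B₀β F)
          (fun i : {i : ZdIdx 4 F.L // i.Ω 0 = Set.univ} => (zdGF3 (Matrix (Fin N) (Fin N) ℂ) F.L 1 (len F) i.1).toGFData2) ∧
        LeafH3sup 4 F.L (ne3NperOfRecord₁₁ F 0 0) (ℓ F).ε (b' F) (c' F) (ne3DomOfRecord₁₁ F N 0 0)) :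
    S_N16 (RRec₁₂On (readingOfRecord₁₂ w1 ℓ ne2 ne1) Rg) := by
  letI : CStarAlgebra (Matrix (Fin N) (Fin N) ℂ) := {}
  refine s_N16_rRec₁₂On_readingOfRecord₁₂_of_leafSlot Rg w1 ℓ ne2 ne1 fun F hF => ⟨?_, ?_⟩
  · exact inEndRegime_ofRecord_of_window F (ne3ConstLayerOfRecord₁₁ F N (ℓ F)) (one_le_ne3NperOfRecord₁₁ F 0 0) (hg F)
      (B := 5 * ((4 : ℕ) : ℝ) * F.L * (inp F).B₀) (by have := (inp F).B₀_pos; positivity) (hα2 F) (hε0 F) (hε F) (hΛ₁r F) (hb F).1 (hb F).2 (hC F)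
  · obtain ⟨hT, hP, h3⟩ := hcontent F hF
    -- `0 < Λ₁`: `0 < ε < α ≤ Λ₁∕(1770·B+1) ≤ Λ₁`
    have hΛpos : 0 < (ℓ F).Λ₁ := by
      have hB0 : 0 < 5 * ((4 : ℕ) : ℝ) * F.L * (inp F).B₀ := by
        have := (inp F).B₀_pos; have := HistoryFlow.two_le_L F; positivity
      have hBp : 0 < 1770 * (5 * ((4 : ℕ) : ℝ) * F.L * (inp F).B₀) + 1 := by positivity
      have h := (le_div_iff₀ hBp).1 (hα2 F)
      have hαp : 0 < α F := hα F
      nlinarith only [h, hB0, hαp]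
    exact leafSlot_ofRecord_of_window F (ne3ConstLayerOfRecord₁₁ F N (ℓ F)) (hlen F) (hlen1 F) (hB₁' F) (hBB F) (hc₁' F) (hwin F) (hα F) (hα1 F) (hα2 F)
      (hα3 F) (hα4 F) (hα5 F) (hε F) hΛpos (hΛ₂' F) (hb' F).1 (hb' F).2 (hc' F).1 (hc' F).2 hT hP h3

/-- **THE N16 LINE AT THE READING OF RECORD, CANONICAL HOME `RRec₁₂`, WINDOWED LETTERS**: the same with the content asked once per family carrying a Stage-12 datum of record
(file 8's constant-layer knit `s_N16_rRec₁₂_of_constLayer_leafSlot`, `hconst := rfl`) — dag-n21-d's module 11b binder `h16 : S_N16 (RRec₁₂ (readingOfRecord₁₂ …))`. [folklore] -/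
theorem s_N16_rRec₁₂_readingOfRecord₁₂_of_window
    (hlen : ∀ (F : T4Family) (v : Site 4), 0 < len F v → 1 ≤ len F v) (hlen1 : ∀ (F : T4Family) (μ : Fin 4), len F (e μ) = 1)
    (hB₁' : ∀ F, 0 < B₁' F) (hBB : ∀ F : T4Family, 5 * ((4 : ℕ) : ℝ) * F.L * (inp F).B₀ ≤ B₁' F) (hc₁' : ∀ F, 0 < c₁' F)
    (hwin : ∀ (F : T4Family) (α₀ α₁ : ℝ), 0 < α₀ → 0 < α₁ → α₀ + α₁ ≤ c₁' F →
      α₀ + α₁ ≤ c₁ F ∧ C0 4 * (2 * α₀) ≤ 1 / 3 ∧ 4 * α₀ ≤ c2' 4 F.L ∧ 16 * (B₁' F * (α₀ + α₁)) ≤ 1 ∧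
      Real.exp (4 * (800 * (((4 : ℕ) : ℝ) + 1) ^ 2 * (((4 : ℕ) : ℝ) + 4)) * α₀) * (1 + 8 * (131072 * (((4 : ℕ) : ℝ) + 1) ^ 2) * (B₁' F * (α₀ + α₁))) ≤ 2 ∧
      2 * (B₁' F * (α₀ + α₁)) ≤ c3 4 F.L ∧ ((4 : ℕ) : ℝ) * F.L * α₁ ≤ 1 / 8 ∧ α₀ ≤ cP F ∧ α₁ ≤ cP F ∧ B₁' F * (α₀ + α₁) ≤ cP F ∧
      2 * (B₁' F * (α₀ + α₁)) ^ 2 + 20 * ((4 : ℕ) : ℝ) * α₀ * (B₁' F * (α₀ + α₁)) + 2 * C₂ F * (B₁' F * (α₀ + α₁)) ^ 2 ≤ α₀ + α₁)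
    (hα : ∀ F, 0 < α F) (hα1 : ∀ F, α F ≤ c₁' F / 177)
    (hα2 : ∀ F : T4Family, α F ≤ (ℓ F).Λ₁ / (1770 * (5 * ((4 : ℕ) : ℝ) * F.L * (inp F).B₀) + 1))
    (hα3 : ∀ F : T4Family, α F ≤ c2' 4 F.L / 2)
    (hα4 : ∀ F : T4Family, α F ≤ 1 / ((23040 * (4 : ℝ) ^ 4 * (frameC 4 F.L + 4) ^ 3 + 12) * (1 + curConst 4 F.L) + 1))
    (hα5 : ∀ F, α F ≤ 1 / 10 ^ 9)
    (hg : ∀ F, 0 < (ℓ F).g) (hε0 : ∀ F, 0 < (ℓ F).ε) (hε : ∀ F, (ℓ F).ε < α F)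
    (hΛ₁r : ∀ F : T4Family, (ℓ F).Λ₁ ≤ radiusOfRecord N F.L (ne3NperOfRecord₁₁ F 0 0))
    (hb : ∀ F, 0 ≤ (ℓ F).b ∧ (ℓ F).b ≤ (ℓ F).ε / 2) (hC : ∀ F : T4Family, constOfRecord N F.L (ne3NperOfRecord₁₁ F 0 0) (ℓ F).g ≤ (ℓ F).C)
    (hΛ₂' : ∀ F : T4Family, 177 * α F * (5 * ((4 : ℕ) : ℝ) * F.L * B₀β F + 5 * ((4 : ℕ) : ℝ) * F.L * (inp F).B₀) ≤ (ℓ F).Λ₂')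
    (hb' : ∀ F, 0 ≤ b' F ∧ b' F ≤ α F ^ 2) (hc' : ∀ F, 0 ≤ c' F ∧ c' F ≤ α F ^ 2)
    (hcontent : ∀ (F : T4Family), (∃ D : Datum F N, IsDatumOfRecord₁₂C F N D) →
      letI : CStarAlgebra (Matrix (Fin N) (Fin N) ℂ) := {}
      B8.Thm4Body (c₁ F) (B₁' F) (fun i : {i : ZdIdx 4 F.L // i.Ω 0 = Set.univ} => (zdGF3 (Matrix (Fin N) (Fin N) ℂ) F.L 1 (len F) i.1).toGFData) ∧
        B8.Prop3Body (cP F) 4 (F.L : ℝ) (C₂ F) (inp F) (B₀β F)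
          (fun i : {i : ZdIdx 4 F.L // i.Ω 0 = Set.univ} => (zdGF3 (Matrix (Fin N) (Fin N) ℂ) F.L 1 (len F) i.1).toGFData2) ∧
        LeafH3sup 4 F.L (ne3NperOfRecord₁₁ F 0 0) (ℓ F).ε (b' F) (c' F) (ne3DomOfRecord₁₁ F N 0 0)) :
    S_N16 (RRec₁₂ (readingOfRecord₁₂ w1 ℓ ne2 ne1)) := by
  letI : CStarAlgebra (Matrix (Fin N) (Fin N) ℂ) := {}
  refine s_N16_rRec₁₂_of_constLayer_leafSlot (readingOfRecord₁₂ w1 ℓ ne2 ne1) (fun F => ne3ConstLayerOfRecord₁₁ F N (ℓ F)) (fun _ _ _ _ _ _ => rfl)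
    fun F hF => ⟨?_, ?_⟩
  · exact inEndRegime_ofRecord_of_window F (ne3ConstLayerOfRecord₁₁ F N (ℓ F)) (one_le_ne3NperOfRecord₁₁ F 0 0) (hg F)
      (B := 5 * ((4 : ℕ) : ℝ) * F.L * (inp F).B₀) (by have := (inp F).B₀_pos; positivity) (hα2 F) (hε0 F) (hε F) (hΛ₁r F) (hb F).1 (hb F).2 (hC F)
  · obtain ⟨hT, hP, h3⟩ := hcontent F hF
    -- `0 < Λ₁`: `0 < ε < α ≤ Λ₁∕(1770·B+1) ≤ Λ₁`
    have hΛpos : 0 < (ℓ F).Λ₁ := by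
      have hB0 : 0 < 5 * ((4 : ℕ) : ℝ) * F.L * (inp F).B₀ := by
        have := (inp F).B₀_pos; have := HistoryFlow.two_le_L F; positivity
      have hBp : 0 < 1770 * (5 * ((4 : ℕ) : ℝ) * F.L * (inp F).B₀) + 1 := by positivity
      have h := (le_div_iff₀ hBp).1 (hα2 F)
      have hαp : 0 < α F := hα F
      nlinarith only [h, hB0, hαp]
    exact leafSlot_ofRecord_of_window F (ne3ConstLayerOfRecord₁₁ F N (ℓ F)) (hlen F) (hlen1 F) (hB₁' F) (hBB F) (hc₁' F) (hwin F) (hα F) (hα1 F) (hα2 F)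
      (hα3 F) (hα4 F) (hα5 F) (hε F) hΛpos (hΛ₂' F) (hb' F).1 (hb' F).2 (hc' F).1 (hc' F).2 hT hP h3

end ReadingOfRecord

end

end Summit.QuantumFields.YangMills.BalabanUVNodes.N16SlotWindowReading
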